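import Summits.ValiantsHypothesis.ValiantsHypothesis.Theorems.GrenetZeonDualUnipotentThreeHalvesHeavyTopLevelTwoChart

/-!
# `GrenetZeon.DualUnipotentThreeHalves` (stmt-ValiantsHypothesis-24318), R2 heavy-top instrument — P-Q1 Level 2, L2.7a (ii) THE LIFT SHAPES:
# `Ê = E_{01} + γ`, `ŵ_j = E_{ωj} + τ_j + γ_j`, and `Z e_0 = Σ_j Z_{ωj} · ŵ_j e_0` for every `Z ∈ V` (input of eng-1 g3's `…HeavyTopLevelTwoFinal`)

Experiment cell «val-heavytop-census» (D-0160), engine seat val-htc-eng-2 g3 (kernel-only lane; P-Q1 port, eng lineage; lead Level-2 port map L2.0/L2.7).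
From ✓ `HeavyTopLevelTwoChart.chart` (envelope `T′`, graded complement `C`, unique lifts) this file READS OFF the letters of Q1-PROOF §2 in the abstract
form requested by eng-1 g3 (INBOX 03:35Z) for L2.5/L2.7b: ★ `lifts` — there are `Ê ∈ V`, `Ê = E_{01} + γ` (`γ` supported in column `ω`, `γ_{ωω} = 0`,
`γ_{qω} = 0` for `q < c` and for `q = s−1`), and for every `c < j < s` an element `ŵ_j ∈ V`, `ŵ_j = E_{ωj} + τ_j + γ_j` (`τ_j` with zero row `ω` and zero
column `ω`, `tr τ_j = 0`, `τ_j (s−1) 0 = 0`, lower triangular with diagonal in the block; `γ_j` supported in column `ω`), such that for EVERY `Z ∈ V`: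
`Z e_0 = Σ_{c<j<s} Z_{ωj} · (ŵ_j e_0)` (all other chart generators — `A`, the exact `E_{iω}`, the block-unit lifts `E_{ab} +` column-`ω` tail — kill `e_0`,
and `Z` is the combination of the lifts with the coefficients of its own `W⁽ᶜ⁾`-entries because `V ⊓ C = ⊥`).

Honest framing: a step of the instrument's kernel port P-Q1 (Level 2); nothing here proves or refutes `HeavyTopLaw`/`HeavyTopSlowLaw`, 24318, S3 or 8062;
`VP ≠ VNP` is NOT proved.  No definitions.  [Q1-PROOF §2 (val-htc-lead g2); this seat]
-/

noncomputable section

-- single-conjunct layout: Sub = Summit, duplicated namespace component intended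
set_option linter.dupNamespace false

namespace Summit.ValiantsHypothesis.ValiantsHypothesis.Theorems.GrenetZeon.HeavyTopLevelTwoLifts

open Matrix
open Summit.ValiantsHypothesis.ValiantsHypothesis.Theorems.GrenetZeon.HeavyTopLevelTwoChart (chart)

/-- ★ **The lift shapes and the `e_0`-decomposition (L2.7a (ii)).**  See the module docstring. [Q1-PROOF §2 CHART] -/
theorem lifts {s : ℕ} (hs : 3 ≤ s) (A : Matrix (Fin (s + 1)) (Fin (s + 1)) ℂ)
    (hA : ∀ i j : Fin (s + 1), A i j = if (j : ℕ) = i + 1 ∧ (j : ℕ) < s then 1 else 0)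
    (V W : Submodule ℂ (Matrix (Fin (s + 1)) (Fin (s + 1)) ℂ)) (hV : ∀ Z ∈ V, Z ^ s = 0) (hAV : A ∈ V)
    (hfin : Module.finrank ℂ W = Module.finrank ℂ V)
    (hWinit : ∀ Z ∈ V, ∀ d : ℤ, (∀ a b : Fin (s + 1),
        ((fun x : Fin (s + 1) => if x = Fin.last s then (0 : ℕ) else 1) a : ℤ) -
          (fun x : Fin (s + 1) => if x = Fin.last s then (0 : ℕ) else 1) b < d → Z a b = 0) →
      (Matrix.of fun a b : Fin (s + 1) =>
        if ((fun x : Fin (s + 1) => if x = Fin.last s then (0 : ℕ) else 1) a : ℤ) -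
            (fun x : Fin (s + 1) => if x = Fin.last s then (0 : ℕ) else 1) b = d then Z a b else 0) ∈ W)
    (c : ℕ) (hc : c ≤ s - 1)
    (hshape : ∀ Z : Matrix (Fin (s + 1)) (Fin (s + 1)) ℂ, Z ∈ W ↔ ∀ a b : Fin (s + 1), Z a b ≠ 0 →
      (a.val < b.val ∧ b ≠ Fin.last s) ∨ (b = Fin.last s ∧ a.val < c) ∨ (a = Fin.last s ∧ c < b.val ∧ b ≠ Fin.last s)) :
    ∃ (E γ : Matrix (Fin (s + 1)) (Fin (s + 1)) ℂ) (w τ γ' : Fin (s + 1) → Matrix (Fin (s + 1)) (Fin (s + 1)) ℂ)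
      (Lb tb : Fin (s + 1) → Fin (s + 1) → Matrix (Fin (s + 1)) (Fin (s + 1)) ℂ),
      (E ∈ V ∧ E = Matrix.single 0 1 (1 : ℂ) + γ ∧ (∀ p r : Fin (s + 1), r ≠ Fin.last s → γ p r = 0) ∧ γ (Fin.last s) (Fin.last s) = 0 ∧
        (∀ q : Fin (s + 1), (q.val < c ∨ q.val = s - 1) → γ q (Fin.last s) = 0)) ∧
      (∀ j : Fin (s + 1), c < j.val → j.val < s →
        w j ∈ V ∧ w j = Matrix.single (Fin.last s) j (1 : ℂ) + τ j + γ' j ∧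
        (∀ r, τ j (Fin.last s) r = 0) ∧ (∀ p, τ j p (Fin.last s) = 0) ∧ Matrix.trace (τ j) = 0 ∧
        τ j ⟨s - 1, by omega⟩ 0 = 0 ∧ (∀ p r : Fin (s + 1), p.val < r.val → τ j p r = 0) ∧
        (∀ p r : Fin (s + 1), r ≠ Fin.last s → γ' j p r = 0)) ∧
      (∀ a b : Fin (s + 1), a.val < b.val → b ≠ Fin.last s →
        Lb a b ∈ V ∧ Lb a b = Matrix.single a b (1 : ℂ) + tb a b ∧ (∀ p r : Fin (s + 1), r ≠ Fin.last s → tb a b p r = 0) ∧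
        tb a b (Fin.last s) (Fin.last s) = 0) ∧
      (∀ i : Fin (s + 1), i.val < c → Matrix.single i (Fin.last s) (1 : ℂ) ∈ V) ∧
      (E = Lb 0 1) ∧
      ∀ Z ∈ V, Z = (∑ j : Fin (s + 1), if c < j.val ∧ j.val < s then Z (Fin.last s) j • w j else 0) +
        (∑ a : Fin (s + 1), ∑ b : Fin (s + 1), if a.val < b.val ∧ b ≠ Fin.last s then Z a b • Lb a b else 0) +
        (∑ i : Fin (s + 1), if i.val < c then Z i (Fin.last s) • Matrix.single i (Fin.last s) (1 : ℂ) else 0) := by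
  classical
  set ω : Fin (s + 1) := Fin.last s with hωdef
  have hωv : ω.val = s := by simp [hωdef]
  have hω0 : (0 : Fin (s + 1)) ≠ ω := fun e => by rw [Fin.ext_iff, hωv] at e; simp at e; omega
  set ρ : Fin (s + 1) → ℕ := fun x => if x = ω then 0 else 1 with hρ
  have hdeg : ∀ a b : Fin (s + 1), ((ρ a : ℤ) - ρ b = 1 ↔ (a ≠ ω ∧ b = ω)) ∧ ((ρ a : ℤ) - ρ b = -1 ↔ (a = ω ∧ b ≠ ω)) ∧
      ((ρ a : ℤ) - ρ b = 0 ↔ (a = ω ↔ b = ω)) ∧ (-1 ≤ (ρ a : ℤ) - ρ b ∧ (ρ a : ℤ) - ρ b ≤ 1) := by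
    intro a b
    by_cases ha : a = ω <;> by_cases hb : b = ω <;> simp [hρ, ha, hb]
  obtain ⟨T', C, hT', hC, hVT', hWT', hVC, hT'VC, hlift⟩ := chart hs A hA V W hV hAV hfin hWinit c hc hshape
  -- a matrix all of whose degree components `≤ 1` vanish is zero
  have zero_of_proj : ∀ t : Matrix (Fin (s + 1)) (Fin (s + 1)) ℂ,
      (∀ e : ℤ, e ≤ 1 → (Matrix.of fun a' b' : Fin (s + 1) => if (ρ a' : ℤ) - ρ b' = e then t a' b' else 0) = 0) → t = 0 := by
    intro t ht; ext a b
    have e := congr_fun (congr_fun (ht ((ρ a : ℤ) - ρ b) (hdeg a b).2.2.2.2) a) b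
    simpa using e
  -- entries of a given degree vanish when that component vanishes
  have entry_of_proj : ∀ (t : Matrix (Fin (s + 1)) (Fin (s + 1)) ℂ) (e : ℤ),
      (Matrix.of fun a' b' : Fin (s + 1) => if (ρ a' : ℤ) - ρ b' = e then t a' b' else 0) = 0 →
      ∀ a b : Fin (s + 1), (ρ a : ℤ) - ρ b = e → t a b = 0 := by
    intro t e ht a b hab
    have h := congr_fun (congr_fun ht a) b
    simpa [hab] using h
  -- unit matrices of `W` are homogeneous
  have unit_hom : ∀ (a b : Fin (s + 1)) (d : ℤ), (ρ a : ℤ) - ρ b = d →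
      (Matrix.of fun a' b' : Fin (s + 1) => if (ρ a' : ℤ) - ρ b' = d then Matrix.single a b (1 : ℂ) a' b' else 0) =
        Matrix.single a b 1 := by
    intro a b d hd; ext a' b'
    simp only [Matrix.of_apply]
    by_cases h : a = a' ∧ b = b'
    · obtain ⟨rfl, rfl⟩ := h; rw [if_pos hd]
    · rw [Matrix.single_apply_of_ne _ _ _ _ _ h]; split_ifs <;> rfl
  -- ROW LIFTS
  have hrow : ∀ j : Fin (s + 1), ∃ L τ γ' : Matrix (Fin (s + 1)) (Fin (s + 1)) ℂ, c < j.val → j.val < s →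
      L ∈ V ∧ L = Matrix.single ω j (1 : ℂ) + τ + γ' ∧ (∀ r, τ ω r = 0) ∧ (∀ p, τ p ω = 0) ∧ Matrix.trace τ = 0 ∧
        τ ⟨s - 1, by omega⟩ 0 = 0 ∧ (∀ p r : Fin (s + 1), p.val < r.val → τ p r = 0) ∧ (∀ p r : Fin (s + 1), r ≠ ω → γ' p r = 0) ∧
        L - Matrix.single ω j (1 : ℂ) ∈ C := by
    intro j
    by_cases hj : c < j.val ∧ j.val < s
    · have hjω : j ≠ ω := fun e => by rw [e, hωv] at hj; omega
      have hbW : Matrix.single ω j (1 : ℂ) ∈ W := (hshape _).2 (fun a b hab => by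
        by_cases h : ω = a ∧ j = b
        · obtain ⟨rfl, rfl⟩ := h; exact Or.inr (Or.inr ⟨rfl, hj.1, hjω⟩)
        · exact absurd (Matrix.single_apply_of_ne _ _ _ _ _ h) hab)
      obtain ⟨L, hLV, hLC, hlow, -⟩ := hlift _ hbW (-1) (unit_hom ω j (-1) ((hdeg ω j).2.1.2 ⟨rfl, hjω⟩))
      set t := L - Matrix.single ω j (1 : ℂ) with ht
      obtain ⟨htT, htb, htc, htr⟩ := (hC t).1 hLC
      obtain ⟨ht0, ht1, htω, htσ⟩ := (hT' t).1 htT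
      have hrow0 : ∀ r, r ≠ ω → t ω r = 0 := fun r hr =>
        entry_of_proj t (-1) (hlow (-1) le_rfl) ω r ((hdeg ω r).2.1.2 ⟨rfl, hr⟩)
      refine ⟨L, Matrix.of fun a b : Fin (s + 1) => if a ≠ ω ∧ b ≠ ω then t a b else 0,
        Matrix.of fun a b : Fin (s + 1) => if a ≠ ω ∧ b = ω then t a b else 0, fun _ _ => ⟨hLV, ?_, ?_, ?_, ?_, ?_, ?_, ?_, hLC⟩⟩
      · have e : L = Matrix.single ω j 1 + t := by rw [ht]; abel
        rw [e, add_assoc]; congr 1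
        ext a b; simp only [Matrix.add_apply, Matrix.of_apply]
        by_cases ha : a = ω <;> by_cases hb : b = ω
        · rw [ha, hb]; simp; exact htω
        · rw [ha]; simp [hb, hrow0 b hb]
        · simp [ha, hb]
        · simp [ha, hb]
      · intro r; simp
      · intro p; simp
      · rw [Matrix.trace, Fin.sum_univ_castSucc]
        have hσ0 := htσ 0 (by omega)
        have e : ∀ x : Fin s, (if 0 ≤ x.val then t (Fin.castSucc x) ⟨x.val - 0, by omega⟩ else 0) =
            (Matrix.of fun a b : Fin (s + 1) => if a ≠ ω ∧ b ≠ ω then t a b else 0) (Fin.castSucc x) (Fin.castSucc x) := by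
          intro x
          rw [if_pos (Nat.zero_le _), Matrix.of_apply, if_pos ⟨Fin.castSucc_ne_last x, Fin.castSucc_ne_last x⟩]
          congr 1
        simp only [Matrix.diag_apply]
        simp only [e] at hσ0
        rw [hσ0, zero_add, Matrix.of_apply, if_neg (by simp [hωdef])]
      · have hσ := htσ (s - 1) (by omega)
        rw [Finset.sum_eq_single ⟨s - 1, by omega⟩] at hσ
        · rw [if_pos (by simp)] at hσ
          rw [Matrix.of_apply, if_pos ⟨fun e => by rw [Fin.ext_iff, hωv] at e; simp at e; omega, hω0⟩]
          have e1 : (⟨(⟨s - 1, by omega⟩ : Fin s).val - (s - 1), by omega⟩ : Fin (s + 1)) = 0 := Fin.ext (by simp)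
          rw [e1] at hσ
          exact hσ
        · intro x _ hx
          rw [if_neg]
          intro hle
          exact hx (Fin.ext (by simp; have := x.isLt; omega))
        · intro h; exact absurd (Finset.mem_univ _) h
      · intro p r hpr
        simp only [Matrix.of_apply]
        by_cases h : p ≠ ω ∧ r ≠ ω
        · rw [if_pos h]; exact htb p r h.1 h.2 hpr
        · rw [if_neg h]
      · intro p r hr; simp [hr]
    · exact ⟨0, 0, 0, fun h1 h2 => absurd ⟨h1, h2⟩ hj⟩
  choose w τ γ' hw using hrow
  -- BLOCK-UNIT LIFTS (degree 0): unit + column-ω tail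
  have hblk : ∀ a b : Fin (s + 1), ∃ L t : Matrix (Fin (s + 1)) (Fin (s + 1)) ℂ, a.val < b.val → b ≠ ω →
      L ∈ V ∧ L = Matrix.single a b (1 : ℂ) + t ∧ (∀ p r : Fin (s + 1), r ≠ ω → t p r = 0) ∧ t ω ω = 0 ∧
        (∀ q : Fin (s + 1), (q.val < c ∨ q.val = s - 1) → q ≠ ω → t q ω = 0) ∧ t ∈ C := by
    intro a b
    by_cases hab : a.val < b.val ∧ b ≠ ω
    · have ha : a ≠ ω := fun e => by rw [e, hωv] at hab; have := b.isLt; omega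
      have hbW : Matrix.single a b (1 : ℂ) ∈ W := (hshape _).2 (fun a' b' hab' => by
        by_cases h : a = a' ∧ b = b'
        · obtain ⟨rfl, rfl⟩ := h; exact Or.inl hab
        · exact absurd (Matrix.single_apply_of_ne _ _ _ _ _ h) hab')
      obtain ⟨L, hLV, hLC, hlow, -⟩ := hlift _ hbW 0 (unit_hom a b 0 ((hdeg a b).2.2.1.2 (by simp [ha, hab.2])))
      set t := L - Matrix.single a b (1 : ℂ) with ht
      obtain ⟨htT, -, htc, -⟩ := (hC t).1 hLC
      obtain ⟨-, ht1, -, -⟩ := (hT' t).1 htT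
      have hz : ∀ p r : Fin (s + 1), r ≠ ω → t p r = 0 := by
        intro p r hr
        by_cases hp : p = ω
        · exact entry_of_proj t (-1) (hlow (-1) (by omega)) p r ((hdeg p r).2.1.2 ⟨hp, hr⟩)
        · exact entry_of_proj t 0 (hlow 0 le_rfl) p r ((hdeg p r).2.2.1.2 (by simp [hp, hr]))
      refine ⟨L, t, fun _ _ => ⟨hLV, by rw [ht]; abel, hz, ?_, ?_, hLC⟩⟩
      · exact entry_of_proj t 0 (hlow 0 le_rfl) ω ω ((hdeg ω ω).2.2.1.2 (by simp))
      · intro q hq hqω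
        rcases hq with hq | hq
        · exact htc q hqω hq
        · have e : q = ⟨s - 1, by omega⟩ := Fin.ext hq
          rw [e]; exact ht1
    · exact ⟨0, 0, fun h1 h2 => absurd ⟨h1, h2⟩ hab⟩
  choose Lb tb hLb using hblk
  -- COLUMN UNITS are exact
  have hcolu : ∀ i : Fin (s + 1), i.val < c → Matrix.single i ω (1 : ℂ) ∈ V := by
    intro i hi
    have hiω : i ≠ ω := fun e => by rw [e, hωv] at hi; omega
    have hbW : Matrix.single i ω (1 : ℂ) ∈ W := (hshape _).2 (fun a' b' hab' => by
      by_cases h : i = a' ∧ ω = b'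
      · obtain ⟨rfl, rfl⟩ := h; exact Or.inr (Or.inl ⟨rfl, hi⟩)
      · exact absurd (Matrix.single_apply_of_ne _ _ _ _ _ h) hab')
    obtain ⟨L, hLV, -, hlow, -⟩ := hlift _ hbW 1 (unit_hom i ω 1 ((hdeg i ω).1.2 ⟨hiω, rfl⟩))
    have ht : L - Matrix.single i ω 1 = 0 := zero_of_proj _ (fun e he => hlow e he)
    rw [sub_eq_zero] at ht
    rw [← ht]; exact hLV
  -- the `E_{01}` lift
  have hv1 : (1 : Fin (s + 1)).val = 1 := by rw [Fin.val_one']; exact Nat.mod_eq_of_lt (by omega)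
  have h01 : (0 : Fin (s + 1)).val < (1 : Fin (s + 1)).val ∧ (1 : Fin (s + 1)) ≠ ω := by
    refine ⟨by rw [hv1]; simp, fun e => ?_⟩
    rw [Fin.ext_iff, hωv, hv1] at e; omega
  obtain ⟨hEV, hEeq, hγ, hγω, hγq, -⟩ := hLb 0 1 h01.1 h01.2
  refine ⟨Lb 0 1, tb 0 1, w, τ, γ', Lb, tb, ⟨hEV, hEeq, hγ, hγω, fun q hq => ?_⟩,
    fun j hj1 hj2 => ⟨(hw j hj1 hj2).1, (hw j hj1 hj2).2.1, (hw j hj1 hj2).2.2.1, (hw j hj1 hj2).2.2.2.1, (hw j hj1 hj2).2.2.2.2.1,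
      (hw j hj1 hj2).2.2.2.2.2.1, (hw j hj1 hj2).2.2.2.2.2.2.1, (hw j hj1 hj2).2.2.2.2.2.2.2.1⟩,
    fun a b hab hb => ⟨(hLb a b hab hb).1, (hLb a b hab hb).2.1, (hLb a b hab hb).2.2.1, (hLb a b hab hb).2.2.2.1⟩,
    hcolu, rfl, ?_⟩
  · by_cases hqω : q = ω
    · rw [hqω]; exact hγω
    · exact hγq q hq hqω
  -- the decomposition: `Z - Z' ∈ V ⊓ C = ⊥`
  intro Z hZ
  obtain ⟨h0, h1, hω, hσ⟩ := (hT' Z).1 (hVT' hZ)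
  set Z' : Matrix (Fin (s + 1)) (Fin (s + 1)) ℂ :=
    (∑ j : Fin (s + 1), if c < j.val ∧ j.val < s then Z ω j • w j else 0) +
    (∑ a : Fin (s + 1), ∑ b : Fin (s + 1), if a.val < b.val ∧ b ≠ ω then Z a b • Lb a b else 0) +
    (∑ i : Fin (s + 1), if i.val < c then Z i ω • Matrix.single i ω (1 : ℂ) else 0) with hZ'
  have hZ'V : Z' ∈ V := by
    refine V.add_mem (V.add_mem ?_ ?_) ?_
    · refine V.sum_mem fun j _ => ?_
      by_cases hj : c < j.val ∧ j.val < s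
      · rw [if_pos hj]; exact V.smul_mem _ (hw j hj.1 hj.2).1
      · rw [if_neg hj]; exact V.zero_mem
    · refine V.sum_mem fun a _ => V.sum_mem fun b _ => ?_
      by_cases hab : a.val < b.val ∧ b ≠ ω
      · rw [if_pos hab]; exact V.smul_mem _ (hLb a b hab.1 hab.2).1
      · rw [if_neg hab]; exact V.zero_mem
    · refine V.sum_mem fun i _ => ?_
      by_cases hi : i.val < c
      · rw [if_pos hi]; exact V.smul_mem _ (hcolu i hi)
      · rw [if_neg hi]; exact V.zero_mem
  -- the unit part of `Z'` and the tails
  set U : Matrix (Fin (s + 1)) (Fin (s + 1)) ℂ :=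
    (∑ j : Fin (s + 1), if c < j.val ∧ j.val < s then Z ω j • Matrix.single ω j (1 : ℂ) else 0) +
    (∑ a : Fin (s + 1), ∑ b : Fin (s + 1), if a.val < b.val ∧ b ≠ ω then Z a b • Matrix.single a b (1 : ℂ) else 0) +
    (∑ i : Fin (s + 1), if i.val < c then Z i ω • Matrix.single i ω (1 : ℂ) else 0) with hU
  set R : Matrix (Fin (s + 1)) (Fin (s + 1)) ℂ :=
    (∑ j : Fin (s + 1), if c < j.val ∧ j.val < s then Z ω j • (w j - Matrix.single ω j (1 : ℂ)) else 0) +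
    (∑ a : Fin (s + 1), ∑ b : Fin (s + 1), if a.val < b.val ∧ b ≠ ω then Z a b • tb a b else 0) with hR
  have hZ'UR : Z' = U + R := by
    rw [hZ', hU, hR]
    have e1 : ∀ j : Fin (s + 1), (if c < j.val ∧ j.val < s then Z ω j • w j else 0) =
        (if c < j.val ∧ j.val < s then Z ω j • Matrix.single ω j (1 : ℂ) else 0) +
          (if c < j.val ∧ j.val < s then Z ω j • (w j - Matrix.single ω j (1 : ℂ)) else 0) := by
      intro j
      by_cases hj : c < j.val ∧ j.val < s
      · rw [if_pos hj, if_pos hj, if_pos hj, ← smul_add]; congr 1; abel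
      · rw [if_neg hj, if_neg hj, if_neg hj, add_zero]
    have e2 : ∀ a b : Fin (s + 1), (if a.val < b.val ∧ b ≠ ω then Z a b • Lb a b else 0) =
        (if a.val < b.val ∧ b ≠ ω then Z a b • Matrix.single a b (1 : ℂ) else 0) +
          (if a.val < b.val ∧ b ≠ ω then Z a b • tb a b else 0) := by
      intro a b
      by_cases hab : a.val < b.val ∧ b ≠ ω
      · rw [if_pos hab, if_pos hab, if_pos hab, (hLb a b hab.1 hab.2).2.1, smul_add]
      · rw [if_neg hab, if_neg hab, if_neg hab, add_zero]
    simp only [e1, e2, Finset.sum_add_distrib]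
    abel
  have hRC : R ∈ C := by
    refine C.add_mem (C.sum_mem fun j _ => ?_) (C.sum_mem fun a _ => C.sum_mem fun b _ => ?_)
    · by_cases hj : c < j.val ∧ j.val < s
      · rw [if_pos hj]; exact C.smul_mem _ (hw j hj.1 hj.2).2.2.2.2.2.2.2.2
      · rw [if_neg hj]; exact C.zero_mem
    · by_cases hab : a.val < b.val ∧ b ≠ ω
      · rw [if_pos hab]; exact C.smul_mem _ (hLb a b hab.1 hab.2).2.2.2.2.2
      · rw [if_neg hab]; exact C.zero_mem
  -- entries of the unit part: `U a b = Z a b` at the `W`-positions, `0` elsewhere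
  have hUapply : ∀ a b : Fin (s + 1), U a b =
      if (a.val < b.val ∧ b ≠ ω) ∨ (b = ω ∧ a.val < c) ∨ (a = ω ∧ c < b.val ∧ b ≠ ω) then Z a b else 0 := by
    intro a b
    have srow : (∑ j : Fin (s + 1), if c < j.val ∧ j.val < s then Z ω j • Matrix.single ω j (1 : ℂ) else 0) a b =
        if a = ω ∧ c < b.val ∧ b ≠ ω then Z a b else 0 := by
      rw [Matrix.sum_apply, Finset.sum_eq_single b]
      · by_cases hb : c < b.val ∧ b.val < s
        · rw [if_pos hb, Matrix.smul_apply]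
          by_cases ha : a = ω
          · rw [ha]; simp [hb.1, show b ≠ ω from fun e => by rw [e, hωv] at hb; omega]
          · rw [Matrix.single_apply_of_ne _ _ _ _ _ (fun h => ha h.1.symm), smul_zero, if_neg (fun h => ha h.1)]
        · rw [if_neg hb, Matrix.zero_apply, if_neg]
          rintro ⟨-, h2, h3⟩
          exact hb ⟨h2, by have := b.isLt; have h4 : b.val ≠ s := fun e => h3 (Fin.ext (by rw [hωv]; exact e)); omega⟩
      · intro j _ hjb
        by_cases hj : c < j.val ∧ j.val < s
        · rw [if_pos hj, Matrix.smul_apply, Matrix.single_apply_of_ne _ _ _ _ _ (fun h => hjb h.2), smul_zero]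
        · rw [if_neg hj, Matrix.zero_apply]
      · intro h; exact absurd (Finset.mem_univ _) h
    have sblk : (∑ a' : Fin (s + 1), ∑ b' : Fin (s + 1),
        if a'.val < b'.val ∧ b' ≠ ω then Z a' b' • Matrix.single a' b' (1 : ℂ) else 0) a b =
        if a.val < b.val ∧ b ≠ ω then Z a b else 0 := by
      rw [Matrix.sum_apply, Finset.sum_eq_single a]
      · rw [Matrix.sum_apply, Finset.sum_eq_single b]
        · by_cases hab : a.val < b.val ∧ b ≠ ω
          · rw [if_pos hab, if_pos hab, Matrix.smul_apply]; simp
          · rw [if_neg hab, if_neg hab, Matrix.zero_apply]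
        · intro b' _ hb'
          by_cases h : a.val < b'.val ∧ b' ≠ ω
          · rw [if_pos h, Matrix.smul_apply, Matrix.single_apply_of_ne _ _ _ _ _ (fun h' => hb' h'.2), smul_zero]
          · rw [if_neg h, Matrix.zero_apply]
        · intro h; exact absurd (Finset.mem_univ _) h
      · intro a' _ ha'
        rw [Matrix.sum_apply]
        refine Finset.sum_eq_zero fun b' _ => ?_
        by_cases h : a'.val < b'.val ∧ b' ≠ ω
        · rw [if_pos h, Matrix.smul_apply, Matrix.single_apply_of_ne _ _ _ _ _ (fun h' => ha' h'.1), smul_zero]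
        · rw [if_neg h, Matrix.zero_apply]
      · intro h; exact absurd (Finset.mem_univ _) h
    have scol : (∑ i : Fin (s + 1), if i.val < c then Z i ω • Matrix.single i ω (1 : ℂ) else 0) a b =
        if b = ω ∧ a.val < c then Z a b else 0 := by
      rw [Matrix.sum_apply, Finset.sum_eq_single a]
      · by_cases ha : a.val < c
        · rw [if_pos ha, Matrix.smul_apply]
          by_cases hb : b = ω
          · rw [hb]; simp [ha]
          · rw [Matrix.single_apply_of_ne _ _ _ _ _ (fun h => hb h.2.symm), smul_zero, if_neg (fun h => hb h.1)]
        · rw [if_neg ha, Matrix.zero_apply, if_neg (fun h => ha h.2)]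
      · intro i _ hia
        by_cases hi : i.val < c
        · rw [if_pos hi, Matrix.smul_apply, Matrix.single_apply_of_ne _ _ _ _ _ (fun h => hia h.1), smul_zero]
        · rw [if_neg hi, Matrix.zero_apply]
      · intro h; exact absurd (Finset.mem_univ _) h
    rw [hU, Matrix.add_apply, Matrix.add_apply, srow, sblk, scol]
    by_cases h1 : a.val < b.val ∧ b ≠ ω
    · have h2 : ¬ (b = ω ∧ a.val < c) := fun h => h1.2 h.1
      have h3 : ¬ (a = ω ∧ c < b.val ∧ b ≠ ω) := fun h => by rw [h.1, hωv] at h1; have := b.isLt; omega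
      rw [if_neg h3, if_pos h1, if_neg h2, if_pos (Or.inl h1)]; ring
    · by_cases h2 : b = ω ∧ a.val < c
      · have h3 : ¬ (a = ω ∧ c < b.val ∧ b ≠ ω) := fun h => h.2.2 h2.1
        rw [if_neg h3, if_neg h1, if_pos h2, if_pos (Or.inr (Or.inl h2))]; ring
      · by_cases h3 : a = ω ∧ c < b.val ∧ b ≠ ω
        · rw [if_pos h3, if_neg h1, if_neg h2, if_pos (Or.inr (Or.inr h3))]; ring
        · rw [if_neg h3, if_neg h1, if_neg h2, if_neg (by tauto)]; ring
  -- `Z - U ∈ C`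
  have hZUC : Z - U ∈ C := by
    have hnotW : ∀ a b : Fin (s + 1), ¬ ((a.val < b.val ∧ b ≠ ω) ∨ (b = ω ∧ a.val < c) ∨ (a = ω ∧ c < b.val ∧ b ≠ ω)) →
        (Z - U) a b = Z a b := fun a b h => by rw [Matrix.sub_apply, hUapply, if_neg h, sub_zero]
    have hW0 : ∀ a b : Fin (s + 1), ((a.val < b.val ∧ b ≠ ω) ∨ (b = ω ∧ a.val < c) ∨ (a = ω ∧ c < b.val ∧ b ≠ ω)) →
        (Z - U) a b = 0 := fun a b h => by rw [Matrix.sub_apply, hUapply, if_pos h, sub_self]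
    refine (hC _).2 ⟨(hT' _).2 ⟨?_, ?_, ?_, fun h hh => ?_⟩, fun a b ha hb hab => hW0 a b (Or.inl ⟨hab, hb⟩),
      fun a ha hac => hW0 a ω (Or.inr (Or.inl ⟨rfl, hac⟩)), fun b hb hcb => hW0 ω b (Or.inr (Or.inr ⟨rfl, hcb, hb⟩))⟩
    · rw [hnotW _ _ (by simp; omega), h0]
    · rw [hnotW, h1]
      push Not
      refine ⟨fun _ => rfl, fun _ => by simp; omega, fun h' => ?_⟩
      rw [Fin.ext_iff, hωv] at h'; simp at h'; omega
    · rw [hnotW _ _ (by simp; omega), hω]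
    · have e : ∀ x : Fin s, (if h ≤ x.val then (Z - U) (Fin.castSucc x) ⟨x.val - h, by omega⟩ else 0) =
          (if h ≤ x.val then Z (Fin.castSucc x) ⟨x.val - h, by omega⟩ else 0) := by
        intro x
        by_cases hx : h ≤ x.val
        · rw [if_pos hx, if_pos hx, hnotW]
          push Not
          refine ⟨fun hlt => absurd hlt (by simp), fun h' => absurd h' ?_, fun h' => absurd h' (Fin.castSucc_ne_last x)⟩
          intro e'; rw [Fin.ext_iff, hωv] at e'; simp at e'; omega
        · rw [if_neg hx, if_neg hx]
      simp only [e]; exact hσ h hh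
  have hdiff : Z - Z' ∈ V ⊓ C := by
    refine ⟨V.sub_mem hZ hZ'V, ?_⟩
    have e : Z - Z' = (Z - U) - R := by rw [hZ'UR]; abel
    rw [e]; exact C.sub_mem hZUC hRC
  rw [hVC, Submodule.mem_bot, sub_eq_zero] at hdiff
  exact hdiff

end Summit.ValiantsHypothesis.ValiantsHypothesis.Theorems.GrenetZeon.HeavyTopLevelTwoLifts

end
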